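import Literature.MathematicalPhysics.QuantumLattice.FermiRG.FST3Main
import Mathlib.Algebra.BigOperators.Intervals
import HarnessLib

/-!
# Feldman–Salmhofer–Trubowitz IV — an inversion theorem in Fermi surface theory
# (§1: the classes `𝓔(δ₀,g₀,G₀,w₀)`, `𝓥`, the truncated counterterm `K^{(R)}`, and Theorem 1)

J. Feldman, M. Salmhofer, E. Trubowitz, *An inversion theorem in Fermi surface theory*, Comm. Pure
Appl. Math. **53** (2000) 1350–1384 = arXiv:math-ph/0001031 ("FST IV").
[cite: FeldmanSalmhoferTrubowitz2000, §1]  Source HELD as `lit read arxiv:math-ph/0001031`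
(the wave's GAP row G-001 "not held" was closed 2026-08-26, D-G-001); locators `p.N:Ln` = chunk
`pNNNN.txt`, line `n`, of that TeX render. STATEMENTS-FIRST typing (gate-hubbard-kl typer wave t5, row
FSTinv.T1): definitions and `Prop`-valued statements only; NOTHING is asserted.

## What is typed, and how

* The setting is that of `FermiRG/FST3Main.lean` (`FST3.Mom`, the norm predicates
  `FST3.CkHolderNormLE k 0` — FST IV's norm is "`|f|_k = Σ_{|α| ≤ k} ‖D^α f‖_∞`" (§1.2 p.4:L27–28 and
  §2.2 (norms) p.6:L143–149), which is EXACTLY `CkHolderNormLE k 0` (sum of sup-norms of the partials) —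
  `FST3.hessQuad`, `FST3.freq/spatial/freqReflect/spatialShift`, and the binder type
  `FST3.Counterterm d` for the FST I counterterm coefficients `K_r(e, V, ·)`).
* §1.1–1.2 (p.3:L53–63, p.4:L4–54): the dual lattice `Γ^#`, `𝓑 = ℝ^d/Γ^#`, "a fundamental cell `𝓕` …
  an open set in `ℝ^d` with the property that it together with its translates under `Γ^#` are dense",
  `𝓕₂ = {𝐩 ∈ 𝓕 : 2𝐩 ∈ 𝓕}`, `S(E) = {E = 0}`, the Fermi sea `𝓘_E = {E < 0}`,
  `C^k_s(𝓑,ℝ) = {E ∈ C^k : E(-𝐩) = E(𝐩)}`, and THE CLASS `𝓔(δ₀,g₀,G₀,w₀)` of dispersion relations,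
  conditions (i)–(iv) verbatim (`InDispersionClass`).
* §1.3 (p.4:L56–84): the class `𝓥` of interactions, conditions (i)–(iv) (`InInteractionClass`).
* §1.4 (p.4:L86–p.5:L14): `K(e,λV,𝐩) = Σ_r λ^r K_r(e,V,𝐩)` "constructed in I" with
  `K_r : 𝓓 × 𝓥 × 𝓑 → ℝ`, and the truncation `K^{(R)}(e, λV) = Σ_{r=1}^R λ^r K_r(e,V)` (`KR`). The
  objects `K_r` are NOT in the tree (GAP row G-t5-1 of the wave): `KR` and Theorem 1 are functions of
  the binder `K : FST3.Counterterm d`; `KR` reads `K` through `FST3.Model` records assembled from the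
  lattice data, `e` and `v̂` (junk value `0` off the periodic functions, never met inside the statements,
  which quantify over `Γ^#`-periodic `e`, `v̂` only).
* §1.5 Theorem 1 (p.5:L28–38), the inversion theorem, PERTURBATIVE ("the perturbation series is
  truncated at any finite order `R`", p.3:L40–44): typed as the schema `theorem1 d K`. QUANTIFIER NOTE
  (flagged, and decided BY THE SOURCE): the print reads "there is a `λ_R > 0` such that for each
  `|λ| ≤ λ_R`, each `E ∈ 𝓔(δ₀,g₀,G₀,w₀) ∩ C³(𝓑,ℝ)` and each `V ∈ 𝓥` …"; the proof (Theorem 2 (3),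
  p.8:L48–67: "`Q = max{Q₀ + Q₁(1 + G₃), D}` … let `λ_R > 0` be such that `Q λ_R < min{1, ε}`", with
  `G₃ = |E|_{3,r}`) and the authors' own Discussion ("`λ_R` depends on `G₃`", §5 p.18:L98–101) make
  `λ_R` depend on a bound `G₃` for the third (radial) derivatives of `E`. We therefore type Theorem 1
  with that bound EXPLICIT: `λ_R, A_R` are chosen after `(δ₀, g₀, G₀, w₀, R, G₃)` and serve every `E`
  with `|E|₃ ≤ G₃` (the Cartesian `C³` norm dominates the radial norm `|·|_{3,r}` up to the chart
  constants of §2.1 — "it does not matter whether we use the norm in Cartesian or polar coordinates since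
  the two are equivalent", p.6:L151–152). `A_R` is uniform (it is `D_R` of Theorem 2 (1),(3),
  p.8:L11–17, L63–67). Uniqueness is typed in the printed class `𝓔(δ₀/2, g₀/2, 2G₀, w₀/2)`.
* NOT typed (no wave licence; reported as DAG ADD candidates): Lemmas 1–3 (§2), Theorem 2 (the
  detailed iteration theorem, §3 p.8:L6–82), Theorem 3 (scale bounds, p.9:L139–185), Theorem 4
  (p.13:L14–33), Lemmas 4–8. Docstring-only remarks: "one expects `λ_R → 0` as `R → ∞`" (ground state
  superconducting, p.5:L45–52); "convergence of the expansion for `K` does not imply that the solution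
  of the inversion equation can be expanded in `λ`. In fact, it can't" (p.5:L63–67); the asymmetric case
  is NOT covered ("(H4') is not stable under an iteration", §5 p.18:L68–80).

Typer lint: no `instance`, no `notation`, no attribute changes.
-/

noncomputable section

open scoped BigOperators

namespace Literature.MathematicalPhysics.QuantumLattice.FermiRG

/-! ### API for the norm predicates of `FST3Main` (the zero function; used for `0 ∈ 𝓥` below) -/

namespace FST3

variable {n : ℕ} {F : Type*} [NormedAddCommGroup F] [NormedSpace ℝ F]

/-- `∂_i 0 = 0`. [cite: FeldmanSalmhoferTrubowitz1999, §1 (1.1) p.1] -/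
theorem partialD_zero (i : Fin n) : partialD i (0 : Mom n → F) = 0 := by
  funext p; simp [partialD, Pi.zero_def]

/-- Iterated partials of `0` vanish. [cite: FeldmanSalmhoferTrubowitz1999, §1 (1.1) p.1] -/
theorem iterPartial_zero (l : List (Fin n)) : iterPartial l (0 : Mom n → F) = 0 := by
  induction l with
  | nil => rfl
  | cons i l ih =>
    show partialD i (iterPartial l 0) = 0
    rw [ih, partialD_zero]

/-- `D^α 0 = 0`. [cite: FeldmanSalmhoferTrubowitz1999, §1 (1.1) p.1] -/
theorem multiPartial_zero (α : Fin n → ℕ) : multiPartial α (0 : Mom n → F) = 0 :=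
  iterPartial_zero _

/-- `|0|_{k,h} ≤ 0`. [cite: FeldmanSalmhoferTrubowitz1999, §1 (1.2) p.1] -/
theorem ckHolderNormLE_zero (k : ℕ) (h : ℝ) : CkHolderNormLE k h (0 : Mom n → F) 0 := by
  refine ⟨fun _ => 0, 0, ?_, le_rfl, ?_, by simp⟩
  · intro α _ p; simp [multiPartial_zero]
  · intro _ α _ x y
    simp only [multiPartial_zero, Pi.zero_apply, sub_self, norm_zero, zero_mul]; exact le_rfl

end FST3

namespace FST4

open FST3

variable {d : ℕ}

/-! ### §1.1–1.2 Lattice data, `𝓕₂`, `C²_s`, and the class `𝓔(δ₀, g₀, G₀, w₀)` -/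

/-- The lattice data of FST IV §1.1–1.2: the dual lattice "`Γ^# = {𝐛 ∈ ℝ^d : 𝐛·γ ∈ 2πℤ for all γ ∈ Γ}`"
of "a nondegenerate lattice `Γ` in `ℝ^d`", acting on momentum space (`𝓑 = ℝ^d/Γ^#`, p.3:L53–63), and
"a fundamental cell `𝓕` for the action of the translation group `Γ^#` … an open set in `ℝ^d` with the
property that it together with its translates under `Γ^#` are dense in `ℝ^d`. For example, if `Γ = ℤ^d`,
then `Γ^# = 2πℤ^d` and we may choose `𝓕 = (-π,π)^d`" (p.4:L6–11). As in `FST3.Model`, the record does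
not enforce the lattice/fundamental-cell axioms (the statements use `latt` through periodicity and
`fund` through `𝓕₂` only). [cite: FeldmanSalmhoferTrubowitz2000, §1.2 p.4] -/
structure LatticeData (d : ℕ) where
  /-- the dual lattice `Γ^#` -/
  latt : Set (Mom d)
  /-- a fundamental cell `𝓕` (open; `Γ^#`-translates dense) -/
  fund : Set (Mom d)

/-- "`𝓕₂ = {𝐩 ∈ 𝓕 : 2𝐩 ∈ 𝓕}`" (p.4:L12). [cite: FeldmanSalmhoferTrubowitz2000, §1.2 p.4] -/
def LatticeData.fund₂ (L : LatticeData d) : Set (Mom d) :=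
  L.fund ∩ ((fun p : Mom d => (2 : ℝ) • p) ⁻¹' L.fund)

/-- A function on `𝓑 = ℝ^d/Γ^#`, i.e. `Γ^#`-periodic on `ℝ^d`. [cite: FeldmanSalmhoferTrubowitz2000, §1.1 p.3] -/
def LatticeData.Periodic (L : LatticeData d) {G : Type*} (f : Mom d → G) : Prop :=
  ∀ γ ∈ L.latt, ∀ p, f (p + γ) = f p

/-- "`C^k_s(𝓑, ℝ) = {E ∈ C^k(𝓑, ℝ) : E(-𝐩) = E(𝐩) for all 𝐩 ∈ 𝓑}`" (p.4:L22–25), here for the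
`k = 2` used in `𝓔`: `C²`, `Γ^#`-periodic, inversion-symmetric. [cite: FeldmanSalmhoferTrubowitz2000, §1.2 p.4] -/
def IsSymmC2 (L : LatticeData d) (E : Mom d → ℝ) : Prop :=
  ContDiff ℝ 2 E ∧ L.Periodic E ∧ ∀ p, E (-p) = E p

/-- THE CLASS `𝓔(δ₀, g₀, G₀, w₀)` (p.4:L32–50): "the set of all `E ∈ C²_s(𝓑, ℝ)` that satisfy
(i) `S(E) ⊂ 𝓕₂`, `𝓘_E ≠ ∅`, `𝓘_E ≠ 𝓑`, `d(S(E), ∂𝓕₂) > δ₀`; (ii) `|∇E(𝐩)| > g₀` for all `𝐩 ∈ S(E)`;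
(iii) `|E|₂ < G₀`; (iv) `(t, E''(𝐩) t) > w₀` for all `𝐩 ∈ S(E)` and all unit vectors `t` tangent to
`S(E)` at `𝐩`", where "`S(E) = {𝐩 ∈ 𝓑 : E(𝐩) = 0}`" is the Fermi surface and "`𝓘_E = {𝐩 ∈ 𝓑 : E(𝐩) < 0}`
the corresponding Fermi sea" (p.4:L15–20); "The condition `(t, E''(𝐩) t) > w₀` implies that `S(E)` has
strictly positive curvature everywhere" (p.4:L49–50). Typing: `S(E) ⊂ 𝓕₂` = every zero of `E` has a
`Γ^#`-translate in `𝓕₂`; `d(S(E), ∂𝓕₂) > δ₀` = some `δ' > δ₀` bounds below all distances from the zeros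
of `E` in `𝓕₂` to the frontier of `𝓕₂` (no `infDist` junk); `|E|₂ < G₀` = `|E|₂ ≤ N` for some
`N < G₀` in the norm `Σ_{|α|≤2} ‖D^α E‖_∞` (`FST3.CkHolderNormLE 2 0`).
[cite: FeldmanSalmhoferTrubowitz2000, §1.2 p.4] -/
def InDispersionClass (L : LatticeData d) (δ₀ g₀ G₀ w₀ : ℝ) (E : Mom d → ℝ) : Prop :=
  IsSymmC2 L E ∧
  (∀ p, E p = 0 → ∃ γ ∈ L.latt, p + γ ∈ L.fund₂) ∧
  (∃ p, E p < 0) ∧ (∃ p, ¬ E p < 0) ∧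
  (∃ δ' : ℝ, δ₀ < δ' ∧ ∀ p, E p = 0 → p ∈ L.fund₂ → ∀ x ∈ frontier L.fund₂, δ' ≤ dist p x) ∧
  (∀ p, E p = 0 → g₀ < ‖gradient E p‖) ∧
  (∃ N : ℝ, N < G₀ ∧ CkHolderNormLE 2 0 E N) ∧
  (∀ p, E p = 0 → ∀ t : Mom d, ‖t‖ = 1 → inner ℝ t (gradient E p) = 0 → w₀ < hessQuad E p t)

/-- The admissible constants: "we fix any `δ₀ > 0`, `g₀ > 0`, `w₀ > 0` and `G₀ > max{g₀, w₀}`"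
(p.4:L53–54; also the hypothesis line of Theorem 1). [cite: FeldmanSalmhoferTrubowitz2000, §1.2 p.4] -/
def AdmissibleConstants (δ₀ g₀ G₀ w₀ : ℝ) : Prop :=
  0 < δ₀ ∧ 0 < g₀ ∧ 0 < w₀ ∧ max g₀ w₀ < G₀

/-! ### §1.3 The class `𝓥` of interactions -/

/-- `(p₀, 𝐩) ↦ (p₀, -𝐩)`. [cite: FeldmanSalmhoferTrubowitz2000, §1.3 p.4] -/
def spatialNeg (q : Mom (d + 1)) : Mom (d + 1) :=
  WithLp.toLp 2 fun i => if i = 0 then q 0 else -q i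

/-- THE CLASS `𝓥` of interactions (p.4:L58–73): "the set of all functions `V`, whose Fourier transforms
`v̂(p₀, 𝐩)` obey (i) `|v̂|₂ ≤ 1`; (ii) `v̂(-p₀, 𝐩) = \overline{v̂(p₀, 𝐩)}`; (iii) `v̂(p₀, -𝐩) = v̂(p₀, 𝐩)`;
(iv) there is a bounded function `ṽ ∈ C²(𝓑, ℝ)` and an `α > 0` such that
`limsup_{p₀ → ∞} |p₀|^α sup_𝐩 |v̂(p₀, 𝐩) − ṽ(𝐩)| < ∞`". "Condition (i) implies that … `v̂` is in
`C²(ℝ^{d+1})`" (p.4:L77–78) — typed as `C²` with `|v̂|₂ ≤ 1` in the norm `Σ_{|α|≤2} ‖D^α v̂‖_∞` over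
`ℝ × 𝓑`; `v̂` is a function on `ℝ × 𝓑` (spatially `Γ^#`-periodic); the `limsup` is typed as an eventual
bound `|p₀|^α sup_𝐩 |v̂ − ṽ| ≤ C` for `p₀ ≥ P`. [cite: FeldmanSalmhoferTrubowitz2000, §1.3 p.4] -/
def InInteractionClass (L : LatticeData d) (vhat : Mom (d + 1) → ℂ) : Prop :=
  (∀ γ ∈ L.latt, ∀ q, vhat (spatialShift γ q) = vhat q) ∧
  ContDiff ℝ 2 vhat ∧ CkHolderNormLE 2 0 vhat 1 ∧
  (∀ q, vhat (freqReflect q) = star (vhat q)) ∧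
  (∀ q, vhat (spatialNeg q) = vhat q) ∧
  ∃ vtilde : Mom d → ℝ, L.Periodic vtilde ∧ ContDiff ℝ 2 vtilde ∧ (∃ N : ℝ, ∀ p, ‖vtilde p‖ ≤ N) ∧
    ∃ α C P : ℝ, 0 < α ∧ ∀ q : Mom (d + 1), P ≤ freq q →
      (abs (freq q)) ^ α * ‖vhat q - (vtilde (spatial q) : ℂ)‖ ≤ C

/-- `𝓥` is not empty: the zero interaction obeys (i)–(iv) (with `ṽ = 0`, any `α > 0`) — "The `1` in
the condition `|v̂|₂ ≤ 1` is not a restriction, since … a rescaling of `V` can be absorbed by a rescaling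
of `λ`" (p.4:L80–84). Unfolding check of the typed class. [cite: FeldmanSalmhoferTrubowitz2000, §1.3 p.4] -/
theorem zero_mem_interactionClass (L : LatticeData d) : InInteractionClass L (0 : Mom (d + 1) → ℂ) := by
  refine ⟨fun _ _ _ => rfl, contDiff_const, (ckHolderNormLE_zero 2 0).mono zero_le_one,
    fun _ => by simp, fun _ => rfl, 0, fun _ _ _ => rfl, contDiff_const, ⟨0, fun _ => by simp⟩,
    1, 0, 0, one_pos, ?_⟩
  intro q _
  simp

/-! ### §1.4 The truncated counterterm function `K^{(R)}` over the FST I binder -/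

/-- The FST III model record assembled from lattice data, a band `e` and an interaction `v̂` (both
`Γ^#`-periodic). [cite: FeldmanSalmhoferTrubowitz2000, §1.4 p.4] -/
def modelOf (L : LatticeData d) (e : Mom d → ℝ) (vhat : Mom (d + 1) → ℂ)
    (he : L.Periodic e) (hv : ∀ γ ∈ L.latt, ∀ q, vhat (spatialShift γ q) = vhat q) : Model d where
  latt := L.latt
  fund := L.fund
  e := e
  vhat := vhat
  e_periodic := he
  vhat_periodic := hv

/-- `K_r(e, V, ·)` read off the binder `K : FST3.Counterterm d` at lattice data `L`, band `e` and
interaction `v̂`: "`K_r : 𝓓 × 𝓥 × 𝓑 → ℝ` is defined for a set `𝓓` of dispersion relations `e` with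
`𝓔 ⊂ 𝓓`" (p.4:L95–96). JUNK VALUE `0` when `e` or `v̂` is not `Γ^#`-periodic (outside `𝓓 × 𝓥`; the
statements below never meet it). [cite: FeldmanSalmhoferTrubowitz2000, §1.4 p.4] -/
def coeff (K : Counterterm d) (L : LatticeData d) (vhat : Mom (d + 1) → ℂ) (e : Mom d → ℝ)
    (r : ℕ) : Mom d → ℝ :=
  @dite _ (L.Periodic e ∧ ∀ γ ∈ L.latt, ∀ q, vhat (spatialShift γ q) = vhat q) (Classical.dec _)
    (fun h => K (modelOf L e vhat h.1 h.2) r) (fun _ => 0)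

/-- "the counterterm function to any order `R` in `λ`, `K^{(R)}(e, λV) = Σ_{r=1}^R λ^r K_r(e, V)`"
(p.4:L122–127) — "differentiable in `𝐩` and `e` (and, of course, `C^∞` in `λ` since it is a polynomial
for any finite `R`)". [cite: FeldmanSalmhoferTrubowitz2000, §1.4 p.4] -/
def KR (K : Counterterm d) (L : LatticeData d) (vhat : Mom (d + 1) → ℂ) (R : ℕ) (lam : ℝ)
    (e : Mom d → ℝ) : Mom d → ℝ :=
  fun p => ∑ r ∈ Finset.Icc 1 R, lam ^ r * coeff K L vhat e r p

/-- The inversion equation "`e + K^{(R)}(e, λV) = E`" (p.4:L144–146), to be solved for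
`e = e^{(R)}(E, λV)` ("The dispersion relation `e` that appears in the propagator is only an auxiliary
quantity", p.4:L149–150). [cite: FeldmanSalmhoferTrubowitz2000, §1.4 p.4] -/
def SolvesInversion (K : Counterterm d) (L : LatticeData d) (vhat : Mom (d + 1) → ℂ) (R : ℕ)
    (lam : ℝ) (E e : Mom d → ℝ) : Prop :=
  e + KR K L vhat R lam e = E

/-! ### §1.5 Theorem 1 — the inversion theorem (statement schema over the FST I counterterm) -/

/-- **Theorem 1** (FST IV p.5:L28–38), the perturbative inversion theorem: "Let `δ₀, g₀, w₀ > 0`,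
`G₀ > max{g₀, w₀}` and `R ∈ ℕ`. Then there is a `λ_R > 0` such that for each `|λ| ≤ λ_R`, each
`E ∈ 𝓔(δ₀, g₀, G₀, w₀) ∩ C³(𝓑, ℝ)` and each `V ∈ 𝓥`, there is a unique
`e^{(R)} ∈ 𝓔(δ₀/2, g₀/2, 2G₀, w₀/2)` solving `e + K^{(R)}(e, λV) = E`. Moreover, there is a constant
`A_R > 0` such that `|e^{(R)} − E|₂ ≤ A_R |λ|`."
TYPED READING (see the module docstring; decided by the source): `λ_R` depends, besides
`(δ₀, g₀, G₀, w₀, R)`, on a bound `G₃` for `|E|₃` — Theorem 2 (3) (p.8:L48–67) takes `Q λ_R < min{1,ε}`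
with `Q = max{Q₀ + Q₁(1 + G₃), D_R}`, `G₃ = |E|_{3,r}` ("This is the case if, for example,
`E ∈ 𝓔 ∩ C³`"), and §5 states "`λ_R` depends on `G₃`" (p.18:L98–101); `A_R` (`= D_R`, Theorem 2 (1),
(3)) is uniform. So: for all admissible constants, `R` and `G₃` there are `λ_R, A_R > 0` such that for
all `|λ| ≤ λ_R`, all `E ∈ 𝓔(δ₀,g₀,G₀,w₀)`, `C³` with `|E|₃ ≤ G₃`, and all `V ∈ 𝓥`: existence and
uniqueness of the solution in `𝓔(δ₀/2, g₀/2, 2G₀, w₀/2)` and the bound `|e − E|₂ ≤ A_R|λ|`. `R = 0`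
(`K^{(0)} = 0`, `e = E`) is harmless. A statement about the FST I counterterm coefficients `K` (binder;
GAP G-t5-1): the fact of record is `theorem1 d K_FST`. REMARKS (not typed): "one expects `λ_R → 0` as
`R → ∞`" (p.5:L45–52); the solution "cannot be expanded in `λ`" (p.5:L63–67); symmetric `e` only (§5).
[cite: FeldmanSalmhoferTrubowitz2000, Thm 1 p.5] -/
def theorem1 (d : ℕ) (K : Counterterm d) : Prop :=
  ∀ L : LatticeData d, ∀ δ₀ g₀ G₀ w₀ : ℝ, AdmissibleConstants δ₀ g₀ G₀ w₀ →
    ∀ R : ℕ, ∀ G₃ : ℝ,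
      ∃ lamR : ℝ, 0 < lamR ∧ ∃ AR : ℝ, 0 < AR ∧
        ∀ lam : ℝ, abs lam ≤ lamR →
          ∀ E : Mom d → ℝ, InDispersionClass L δ₀ g₀ G₀ w₀ E → ContDiff ℝ 3 E →
            CkHolderNormLE 3 0 E G₃ →
            ∀ vhat : Mom (d + 1) → ℂ, InInteractionClass L vhat →
              (∃! e : Mom d → ℝ,
                  InDispersionClass L (δ₀ / 2) (g₀ / 2) (2 * G₀) (w₀ / 2) e ∧
                    SolvesInversion K L vhat R lam E e) ∧
              ∀ e : Mom d → ℝ,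
                InDispersionClass L (δ₀ / 2) (g₀ / 2) (2 * G₀) (w₀ / 2) e →
                  SolvesInversion K L vhat R lam E e →
                    CkHolderNormLE 2 0 (e - E) (AR * abs lam)

/-! ### Sanity lemmas (unfolding only) -/

/-- `K^{(0)} = 0`: the order-`0` truncation is the zero function. [cite: FeldmanSalmhoferTrubowitz2000, §1.4 p.4] -/
theorem KR_zero (K : Counterterm d) (L : LatticeData d) (vhat : Mom (d + 1) → ℂ) (lam : ℝ)
    (e : Mom d → ℝ) : KR K L vhat 0 lam e = 0 := by
  funext p
  simp [KR]

/-- At `λ = 0` every truncation vanishes, `K^{(R)}(e, 0·V) = 0` (so `e = E` solves the inversion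
equation). [cite: FeldmanSalmhoferTrubowitz2000, §1.4 p.4] -/
theorem KR_lam_zero (K : Counterterm d) (L : LatticeData d) (vhat : Mom (d + 1) → ℂ) (R : ℕ)
    (e : Mom d → ℝ) : KR K L vhat R 0 e = 0 := by
  funext p
  simp only [KR, Pi.zero_apply]
  refine Finset.sum_eq_zero fun r hr => ?_
  have hr1 : 1 ≤ r := (Finset.mem_Icc.mp hr).1
  simp [zero_pow (by omega : r ≠ 0)]

/-- `e = E` solves the inversion equation at `λ = 0`. [cite: FeldmanSalmhoferTrubowitz2000, §1.4 p.4] -/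
theorem solvesInversion_self_zero (K : Counterterm d) (L : LatticeData d) (vhat : Mom (d + 1) → ℂ)
    (R : ℕ) (E : Mom d → ℝ) : SolvesInversion K L vhat R 0 E E := by
  simp [SolvesInversion, KR_lam_zero]

/-- The symmetric class is inversion-symmetric on the Fermi surface: `E(-𝐩) = 0` iff `E(𝐩) = 0`.
[cite: FeldmanSalmhoferTrubowitz2000, §1.2 p.4] -/
theorem IsSymmC2.zero_neg_iff {L : LatticeData d} {E : Mom d → ℝ} (hE : IsSymmC2 L E) (p : Mom d) :
    E (-p) = 0 ↔ E p = 0 := by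
  rw [hE.2.2 p]

end FST4

end Literature.MathematicalPhysics.QuantumLattice.FermiRG
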